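import Mathlib

/-!
# SCRATCH (scrit-stub_port) — in-Lean sanity checks behind the critic's rulings ρ1/ρ2
Nothing here is booked; finite checks over `𝔽₂` only.
-/

namespace ScritStubPort

/-- the transposition in transvection form and the Weil form on `𝔽₂²` -/
def cT : Matrix (Fin 2) (Fin 2) (ZMod 2) := !![1, 1; 0, 1]
def weil (x y : Fin 2 → ZMod 2) : ZMod 2 := x 0 * y 1 - x 1 * y 0

/-- ρ2(a): `e((c−1)x, y) = 1` whenever `x, y ∉ ℓ_c = ker(c−1)` (`ℓ_c = {v | v 1 = 0}` here). -/
theorem weil_transvection_ne_zero :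
    ∀ x y : Fin 2 → ZMod 2, x 1 ≠ 0 → y 1 ≠ 0 →
      weil ((cT - 1).mulVec x) y = 1 := by decide

/-- ρ2(b): a 1-cocycle value at an involution lies in `ker(1+c)`: `f(c²)=0 ⇒ (1+c)·f(c)=0`;
over `𝔽₂²` with `c = cT`: `ker(1 + cT) = ℓ_c`. -/
theorem ker_one_add_transvection :
    ∀ v : Fin 2 → ZMod 2, (1 + cT).mulVec v = 0 ↔ v 1 = 0 := by decide

/-- ρ2(c): `im(cT − 1) = ℓ_c` as well (so `H¹(ℝ, E[2]) = ker(1+c)/im(c−1) = 0`, matching H-R). -/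
theorem range_transvection_sub_one :
    ∀ w : Fin 2 → ZMod 2, (∃ v : Fin 2 → ZMod 2, (cT - 1).mulVec v = w) ↔ w 1 = 0 := by decide

/-- ρ1(a): the Frobenius-minus-one matrix on `E[2] ⊗ Ω`: `N = [[s,u],[0,s]]` has `N² = s²`
in characteristic 2 (any commutative ring with `2 = 0`). -/
theorem N_sq {R : Type*} [CommRing R] (h2 : (2 : R) = 0) (s u : R) :
    !![s, u; 0, s] * !![s, u; 0, s] = !![s * s, 0; 0, s * s] := by
  have hsu : s * u + u * s = 0 := by
    have : s * u + u * s = 2 * (s * u) := by ring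
    rw [this, h2, zero_mul]
  ext i j; fin_cases i <;> fin_cases j <;> simp [Matrix.mul_apply, Fin.sum_univ_two, hsu]

/-- ρ1(b): `ker N ⊆ {v | s² • v = 0}` — the precision loss of "dividing by `N`" is that of
dividing by `s²` (`= T^{2^{d+1}}·unit` in `Ω_L`). -/
theorem ker_N_le {R : Type*} [CommRing R] (h2 : (2 : R) = 0) (s u : R) (v : Fin 2 → R)
    (hv : (!![s, u; 0, s]).mulVec v = 0) : (s * s) • v = 0 := by
  have h := congrArg ((!![s, u; 0, s] : Matrix (Fin 2) (Fin 2) R).mulVec) hv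
  rw [Matrix.mulVec_mulVec, N_sq h2, Matrix.mulVec_zero] at h
  have h0 := congrFun h 0
  have h1 := congrFun h 1
  simp [Matrix.mulVec, dotProduct, Fin.sum_univ_two] at h0 h1
  ext i; fin_cases i <;> simp [h0, h1]

end ScritStubPort
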